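import Summits.CriticalPhenomena.PercolationContinuityZ3.Theorems.PercNearOneGluingNoHeavyLowerTailSahiGridPatternPairCert

/-!
# `NoHeavyLowerTail` (crux stmt-CriticalPhenomena-4575), Sahi programme P1: the two-orthant functional as a TWO-BLOCK PAIR SUM
# (bookkeeping for the two-orthant identity)

Support file (Sahi cell, seat `prim-sahi-p1`, generation 21; `--supports stmt-CriticalPhenomena-4575`).  Pure proofs, no definitions,
no `sorry`, standard axioms.  Setting of `…SahiGridPatternPairCert`: `[3]^{n+k}` glued from a free block `[3]^n` and a cell block `[3]^k`,
`X` free-measurable with trace `XI`, `Y` cell-measurable with trace `YJ`, `U = X ∪ Y`, and two further finsets `A, A'`.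

THE MATHEMATICS (`sStarD_union_sub_pairCertSlack_eq_pairSum`).  The quantity `sStarD (X∪Y) A A' − Φ(A∩A')` — `Φ` the closed-form
(T)-slack of the pair certificate (`pairCert_slack_eq`; the left side of hypothesis `hS` of `sStarD_cylSet_pairCert_nonneg_of_sStarD_ge`) —
equals the two-block pair sum `Σ_{ξ,η}Σ_{q,r} [ξ δ̸ η][q δ̸ r]·κ_L` of the LOCAL kernel
  `κ_L = 2u₁₁a₁₁a'₁₁ − u₁₁a₂₂a'₂₂ − a₁₁u₂₂a'₂₂ − a'₁₁u₂₂a₂₂ + a₁₁a'₂₂u₃₃ − a₁₁a'₁₁[(1−y₁)(x₁−x₂) + (1−x₁)(1−x₂)(y₁−y₂)]`,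
`x_i = 1_{XI}` at `ξ, η, ξ̄η`, `y_j = 1_{YJ}` at `q, r, q̄r`, `u_ij = x_i + y_j − x_iy_j`, `a_ij = 1_A(glue · ·)`, `a'_ij = 1_{A'}(glue · ·)`
(counting form `sStarD_counting` of the pattern functional, glued coordinates, `ν` as indicator sums).  Used in `…SahiGridPatternTwoOrthant`. [this work]
-/

namespace Summit.CriticalPhenomena.PercolationContinuityZ3.Theorems.SahiGridPattern

open Finset SahiGrid3
open scoped BigOperators

variable {n k : ℕ}

/-- A single sum over `[3]^{n+k}` as a two-block pair sum: `2^n·2^k·Σ_x g(x) = Σ_{ξ,η,q,r}[ξ δ̸ η][q δ̸ r]·g(glue ξ q)`. [this work] -/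
theorem sum_eq_pairSum_const (g : Pd (n + k) → ℤ) :
    2 ^ n * 2 ^ k * (∑ x : Pd (n + k), g x) =
      ∑ ξ : Pd n, ∑ η : Pd n, ∑ q : Pd k, ∑ r : Pd k,
        (if TotDist ξ η = true then (1:ℤ) else 0) * (if TotDist q r = true then (1:ℤ) else 0) * g (glue ξ q) := by
  rw [sum_glue, Finset.mul_sum]
  refine Finset.sum_congr rfl fun ξ _ => ?_
  rw [Finset.mul_sum]
  have h : ∀ q : Pd k, 2 ^ n * 2 ^ k * g (glue ξ q) =
      ∑ η : Pd n, ∑ r : Pd k, (if TotDist ξ η = true then (1:ℤ) else 0) * (if TotDist q r = true then (1:ℤ) else 0) * g (glue ξ q) := by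
    intro q
    rw [← sum_ite_totDist_eq_two_pow ξ, ← sum_ite_totDist_eq_two_pow q, Finset.sum_mul_sum, Finset.sum_mul]
    refine Finset.sum_congr rfl fun η _ => ?_
    rw [Finset.sum_mul]
  rw [Finset.sum_congr rfl fun q _ => h q, Finset.sum_comm]

/-- A pair sum over `[3]^{n+k}` with the totally-distinct weight as a two-block pair sum. [this work] -/
theorem pairSum_glue (G : Pd (n + k) → Pd (n + k) → ℤ) :
    (∑ x : Pd (n + k), ∑ y : Pd (n + k), G x y * (if TotDist x y = true then (1:ℤ) else 0)) =
      ∑ ξ : Pd n, ∑ η : Pd n, ∑ q : Pd k, ∑ r : Pd k,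
        (if TotDist ξ η = true then (1:ℤ) else 0) * (if TotDist q r = true then (1:ℤ) else 0) * G (glue ξ q) (glue η r) := by
  rw [sum_glue]
  refine Finset.sum_congr rfl fun ξ _ => ?_
  have h : ∀ q : Pd k, (∑ y : Pd (n + k), G (glue ξ q) y * (if TotDist (glue ξ q) y = true then (1:ℤ) else 0)) =
      ∑ η : Pd n, ∑ r : Pd k, (if TotDist ξ η = true then (1:ℤ) else 0) * (if TotDist q r = true then (1:ℤ) else 0) * G (glue ξ q) (glue η r) := by
    intro q
    rw [sum_glue]
    refine Finset.sum_congr rfl fun η _ => Finset.sum_congr rfl fun r _ => ?_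
    rw [totDist_symm, ite_totDist_glue, totDist_symm η ξ, totDist_symm r q]; ring
  rw [Finset.sum_congr rfl fun q _ => h q, Finset.sum_comm]

/-- `ν` of a free-block trace as a pair weight: `2^n·1_{XI}(ξ) − ν_{XI}(ξ) = Σ_η [ξ δ̸ η](1_{XI}(ξ) − 1_{XI}(η))`. [this work] -/
theorem harrisWeight_eq_sum {d : ℕ} (S : Finset (Pd d)) (ξ : Pd d) :
    2 ^ d * ind S ξ - (nuCount S ξ : ℤ) = ∑ η : Pd d, (if TotDist ξ η = true then (1:ℤ) else 0) * (ind S ξ - ind S η) := by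
  rw [nuCount_eq_sum_ind, ← sum_ite_totDist_eq_two_pow ξ, Finset.sum_mul, ← Finset.sum_sub_distrib]
  refine Finset.sum_congr rfl fun η _ => ?_
  rw [totDist_symm η ξ]; ring

/-- `2^d − ν_S(ξ) = Σ_η [ξ δ̸ η](1 − 1_S(η))`. [this work] -/
theorem coHarrisWeight_eq_sum {d : ℕ} (S : Finset (Pd d)) (ξ : Pd d) :
    2 ^ d - (nuCount S ξ : ℤ) = ∑ η : Pd d, (if TotDist ξ η = true then (1:ℤ) else 0) * (1 - ind S η) := by
  rw [nuCount_eq_sum_ind, ← sum_ite_totDist_eq_two_pow ξ, ← Finset.sum_sub_distrib]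
  refine Finset.sum_congr rfl fun η _ => ?_
  rw [totDist_symm η ξ]; ring

/-- `a·(Σ f)·(Σ g) = Σ_i Σ_j a·f(i)·g(j)` (bookkeeping). [this work] -/
theorem mul_sum_mul_sum {α β : Type*} [Fintype α] [Fintype β] (a : ℤ) (f : α → ℤ) (g : β → ℤ) :
    a * (∑ i, f i) * (∑ j, g j) = ∑ i, ∑ j, a * f i * g j := by
  have h : a * (∑ i, f i) = ∑ i, a * f i := Finset.mul_sum _ _ _
  rw [h, Finset.sum_mul_sum]

/-- **THE TWO-ORTHANT FUNCTIONAL AS A TWO-BLOCK PAIR SUM**: `sStarD (X∪Y) A A' − Φ(A∩A') = Σ_{ξ,η,q,r}[ξ δ̸ η][q δ̸ r]·κ_L`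
(see the file header for `κ_L`). [this work] -/
theorem sStarD_union_sub_pairCertSlack_eq_pairSum {X Y : Finset (Pd (n + k))} {XI : Finset (Pd n)} {YJ : Finset (Pd k)}
    (hX : ∀ ξ q, glue ξ q ∈ X ↔ ξ ∈ XI) (hY : ∀ ξ q, glue ξ q ∈ Y ↔ q ∈ YJ) (A A' : Finset (Pd (n + k))) :
    sStarD (X ∪ Y) A A'
      - (2 ^ k * (∑ q : Pd k, (1 - ind YJ q) * ∑ ξ : Pd n, ind (fibre (A ∩ A') q) ξ * (2 ^ n * ind XI ξ - (nuCount XI ξ : ℤ)))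
        + (∑ ξ : Pd n, (1 - ind XI ξ) * (2 ^ n - (nuCount XI ξ : ℤ)) * ∑ q : Pd k, ind (sect (A ∩ A') ξ) q * (2 ^ k * ind YJ q - (nuCount YJ q : ℤ))))
      = ∑ ξ : Pd n, ∑ η : Pd n, ∑ q : Pd k, ∑ r : Pd k,
          (if TotDist ξ η = true then (1:ℤ) else 0) * (if TotDist q r = true then (1:ℤ) else 0) *
          ( 2 * (ind XI ξ + ind YJ q - ind XI ξ * ind YJ q) * ind A (glue ξ q) * ind A' (glue ξ q)
            - (ind XI ξ + ind YJ q - ind XI ξ * ind YJ q) * ind A (glue η r) * ind A' (glue η r)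
            - ind A (glue ξ q) * (ind XI η + ind YJ r - ind XI η * ind YJ r) * ind A' (glue η r)
            - ind A' (glue ξ q) * (ind XI η + ind YJ r - ind XI η * ind YJ r) * ind A (glue η r)
            + ind A (glue ξ q) * ind A' (glue η r)
                * (ind XI (thirdPt ξ η) + ind YJ (thirdPt q r) - ind XI (thirdPt ξ η) * ind YJ (thirdPt q r))
            - ind A (glue ξ q) * ind A' (glue ξ q)
                * ((1 - ind YJ q) * (ind XI ξ - ind XI η) + (1 - ind XI ξ) * (1 - ind XI η) * (ind YJ q - ind YJ r)) ) := by
  -- the union indicator in block form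
  have hU : ∀ (ξ : Pd n) (q : Pd k), ind (X ∪ Y) (glue ξ q) = ind XI ξ + ind YJ q - ind XI ξ * ind YJ q := by
    intro ξ q; rw [ind_union_eq, ind_glue_of_free hX, ind_glue_of_cell hY]
  -- the five terms of the counting form
  rw [sStarD_counting]
  have e1 : 2 * 2 ^ (n + k) * (∑ p : Pd (n + k), ind (X ∪ Y) p * ind A p * ind A' p) =
      ∑ ξ : Pd n, ∑ η : Pd n, ∑ q : Pd k, ∑ r : Pd k, (if TotDist ξ η = true then (1:ℤ) else 0) * (if TotDist q r = true then (1:ℤ) else 0) *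
        (2 * (ind XI ξ + ind YJ q - ind XI ξ * ind YJ q) * ind A (glue ξ q) * ind A' (glue ξ q)) := by
    have hc : 2 * (2:ℤ) ^ (n + k) * (∑ p : Pd (n + k), ind (X ∪ Y) p * ind A p * ind A' p)
        = 2 ^ n * 2 ^ k * (∑ p : Pd (n + k), 2 * (ind (X ∪ Y) p * ind A p * ind A' p)) := by
      rw [pow_add, Finset.mul_sum, Finset.mul_sum]
      refine Finset.sum_congr rfl fun p _ => ?_
      ring
    rw [hc, sum_eq_pairSum_const]
    refine Finset.sum_congr rfl fun ξ _ => Finset.sum_congr rfl fun η _ => Finset.sum_congr rfl fun q _ => Finset.sum_congr rfl fun r _ => ?_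
    rw [hU]; ring
  have e2 : (∑ p : Pd (n + k), ∑ q' : Pd (n + k), ind (X ∪ Y) p * ind A q' * ind A' q' * (if TotDist p q' = true then (1:ℤ) else 0)) =
      ∑ ξ : Pd n, ∑ η : Pd n, ∑ q : Pd k, ∑ r : Pd k, (if TotDist ξ η = true then (1:ℤ) else 0) * (if TotDist q r = true then (1:ℤ) else 0) *
        ((ind XI ξ + ind YJ q - ind XI ξ * ind YJ q) * ind A (glue η r) * ind A' (glue η r)) := by
    rw [pairSum_glue (fun p q' => ind (X ∪ Y) p * ind A q' * ind A' q')]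
    refine Finset.sum_congr rfl fun ξ _ => Finset.sum_congr rfl fun η _ => Finset.sum_congr rfl fun q _ => Finset.sum_congr rfl fun r _ => ?_
    rw [hU]
  have e3 : (∑ p : Pd (n + k), ∑ q' : Pd (n + k), ind A p * ind (X ∪ Y) q' * ind A' q' * (if TotDist p q' = true then (1:ℤ) else 0)) =
      ∑ ξ : Pd n, ∑ η : Pd n, ∑ q : Pd k, ∑ r : Pd k, (if TotDist ξ η = true then (1:ℤ) else 0) * (if TotDist q r = true then (1:ℤ) else 0) *
        (ind A (glue ξ q) * (ind XI η + ind YJ r - ind XI η * ind YJ r) * ind A' (glue η r)) := by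
    rw [pairSum_glue (fun p q' => ind A p * ind (X ∪ Y) q' * ind A' q')]
    refine Finset.sum_congr rfl fun ξ _ => Finset.sum_congr rfl fun η _ => Finset.sum_congr rfl fun q _ => Finset.sum_congr rfl fun r _ => ?_
    rw [hU]
  have e4 : (∑ p : Pd (n + k), ∑ q' : Pd (n + k), ind A' p * ind (X ∪ Y) q' * ind A q' * (if TotDist p q' = true then (1:ℤ) else 0)) =
      ∑ ξ : Pd n, ∑ η : Pd n, ∑ q : Pd k, ∑ r : Pd k, (if TotDist ξ η = true then (1:ℤ) else 0) * (if TotDist q r = true then (1:ℤ) else 0) *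
        (ind A' (glue ξ q) * (ind XI η + ind YJ r - ind XI η * ind YJ r) * ind A (glue η r)) := by
    rw [pairSum_glue (fun p q' => ind A' p * ind (X ∪ Y) q' * ind A q')]
    refine Finset.sum_congr rfl fun ξ _ => Finset.sum_congr rfl fun η _ => Finset.sum_congr rfl fun q _ => Finset.sum_congr rfl fun r _ => ?_
    rw [hU]
  have e5 : (∑ q' : Pd (n + k), ∑ r' : Pd (n + k), ind A q' * ind A' r' * ind (X ∪ Y) (thirdPt q' r') * (if TotDist q' r' = true then (1:ℤ) else 0)) =
      ∑ ξ : Pd n, ∑ η : Pd n, ∑ q : Pd k, ∑ r : Pd k, (if TotDist ξ η = true then (1:ℤ) else 0) * (if TotDist q r = true then (1:ℤ) else 0) *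
        (ind A (glue ξ q) * ind A' (glue η r)
          * (ind XI (thirdPt ξ η) + ind YJ (thirdPt q r) - ind XI (thirdPt ξ η) * ind YJ (thirdPt q r))) := by
    rw [pairSum_glue (fun q' r' => ind A q' * ind A' r' * ind (X ∪ Y) (thirdPt q' r'))]
    refine Finset.sum_congr rfl fun ξ _ => Finset.sum_congr rfl fun η _ => Finset.sum_congr rfl fun q _ => Finset.sum_congr rfl fun r _ => ?_
    rw [thirdPt_glue, hU]
  -- the two halves of Φ
  have eW : ∀ (ξ : Pd n) (q : Pd k), ind (A ∩ A') (glue ξ q) = ind A (glue ξ q) * ind A' (glue ξ q) := fun ξ q => ind_inter_eq_mul A A' _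
  have f1 : 2 ^ k * (∑ q : Pd k, (1 - ind YJ q) * ∑ ξ : Pd n, ind (fibre (A ∩ A') q) ξ * (2 ^ n * ind XI ξ - (nuCount XI ξ : ℤ))) =
      ∑ ξ : Pd n, ∑ η : Pd n, ∑ q : Pd k, ∑ r : Pd k, (if TotDist ξ η = true then (1:ℤ) else 0) * (if TotDist q r = true then (1:ℤ) else 0) *
        (ind A (glue ξ q) * ind A' (glue ξ q) * ((1 - ind YJ q) * (ind XI ξ - ind XI η))) := by
    -- per (q, ξ): the summand as a double pair sum over (η, r)
    have inner : ∀ (q : Pd k) (ξ : Pd n), 2 ^ k * ((1 - ind YJ q) * (ind (fibre (A ∩ A') q) ξ * (2 ^ n * ind XI ξ - (nuCount XI ξ : ℤ)))) =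
        ∑ η : Pd n, ∑ r : Pd k, (if TotDist ξ η = true then (1:ℤ) else 0) * (if TotDist q r = true then (1:ℤ) else 0) *
          (ind A (glue ξ q) * ind A' (glue ξ q) * ((1 - ind YJ q) * (ind XI ξ - ind XI η))) := by
      intro q ξ
      rw [Finset.sum_comm, ind_fibre, eW, harrisWeight_eq_sum, ← sum_ite_totDist_eq_two_pow q, Finset.sum_mul]
      refine Finset.sum_congr rfl fun r _ => ?_
      rw [Finset.mul_sum, Finset.mul_sum, Finset.mul_sum]
      refine Finset.sum_congr rfl fun η _ => ?_
      ring
    have step : 2 ^ k * (∑ q : Pd k, (1 - ind YJ q) * ∑ ξ : Pd n, ind (fibre (A ∩ A') q) ξ * (2 ^ n * ind XI ξ - (nuCount XI ξ : ℤ))) =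
        ∑ q : Pd k, ∑ ξ : Pd n, ∑ η : Pd n, ∑ r : Pd k, (if TotDist ξ η = true then (1:ℤ) else 0) * (if TotDist q r = true then (1:ℤ) else 0) *
          (ind A (glue ξ q) * ind A' (glue ξ q) * ((1 - ind YJ q) * (ind XI ξ - ind XI η))) := by
      rw [Finset.mul_sum]
      refine Finset.sum_congr rfl fun q _ => ?_
      rw [Finset.mul_sum, Finset.mul_sum]
      exact Finset.sum_congr rfl fun ξ _ => inner q ξ
    rw [step, Finset.sum_comm]
    refine Finset.sum_congr rfl fun ξ _ => ?_
    rw [Finset.sum_comm]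
  have f2 : (∑ ξ : Pd n, (1 - ind XI ξ) * (2 ^ n - (nuCount XI ξ : ℤ)) * ∑ q : Pd k, ind (sect (A ∩ A') ξ) q * (2 ^ k * ind YJ q - (nuCount YJ q : ℤ))) =
      ∑ ξ : Pd n, ∑ η : Pd n, ∑ q : Pd k, ∑ r : Pd k, (if TotDist ξ η = true then (1:ℤ) else 0) * (if TotDist q r = true then (1:ℤ) else 0) *
        (ind A (glue ξ q) * ind A' (glue ξ q) * ((1 - ind XI ξ) * (1 - ind XI η) * (ind YJ q - ind YJ r))) := by
    refine Finset.sum_congr rfl fun ξ _ => ?_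
    have hq : ∀ q : Pd k, ind (sect (A ∩ A') ξ) q * (2 ^ k * ind YJ q - (nuCount YJ q : ℤ)) =
        ∑ r : Pd k, (if TotDist q r = true then (1:ℤ) else 0) * (ind A (glue ξ q) * ind A' (glue ξ q) * (ind YJ q - ind YJ r)) := by
      intro q
      rw [ind_sect, eW, harrisWeight_eq_sum, Finset.mul_sum]
      refine Finset.sum_congr rfl fun r _ => ?_
      ring
    have hq' : (∑ q : Pd k, ind (sect (A ∩ A') ξ) q * (2 ^ k * ind YJ q - (nuCount YJ q : ℤ))) =
        ∑ q : Pd k, ∑ r : Pd k, (if TotDist q r = true then (1:ℤ) else 0) * (ind A (glue ξ q) * ind A' (glue ξ q) * (ind YJ q - ind YJ r)) :=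
      Finset.sum_congr rfl fun q _ => hq q
    rw [hq', coHarrisWeight_eq_sum, mul_sum_mul_sum]
    refine Finset.sum_congr rfl fun η _ => Finset.sum_congr rfl fun q _ => ?_
    rw [Finset.mul_sum]
    refine Finset.sum_congr rfl fun r _ => ?_
    ring
  rw [e1, e2, e3, e4, e5, f1, f2]
  simp only [← Finset.sum_sub_distrib, ← Finset.sum_add_distrib]
  refine Finset.sum_congr rfl fun ξ _ => Finset.sum_congr rfl fun η _ => Finset.sum_congr rfl fun q _ => Finset.sum_congr rfl fun r _ => ?_
  ring

end Summit.CriticalPhenomena.PercolationContinuityZ3.Theorems.SahiGridPattern
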